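import Literature.AlgebraicGeometry.AbelianSchemes.WeilPairingHom                     -- ★ `comp_zsmul_id_hom_eq_pow'` (torsion pins ↔ powers)
import Literature.AlgebraicGeometry.AbelianSchemes.WeilDualityPolarizationTransport    -- ★ `comp_zsmul_id_hom_eq`, `mono_of_isClosedImmersion_left`
import Literature.AlgebraicGeometry.AbelianSchemes.AbelianSchemeOverMulNFiniteFlat     -- ★ `[a]` finite, flat, surjective
import Literature.AlgebraicGeometry.GroupSchemes.CartierDualBidualNatural              -- ★ `cartierDualMap_of_eq_one`
import HarnessLib

/-!
# The SHIFTED isotropy of the kernel of a polarised isogeny, through a NATURAL Weil duality: `⟨x₀, 𝒦⟩ = 1` for `m·x₀ ∈ Ker q̄`, `𝒦 ⊆ Ker q̄`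
# ([Mumford AV] §20 (I) p. 186 «`e_n(f x, ŷ) = e_n(x, f^∨ ŷ)`», §23 Thm. 2 (p. 231); [Milne AV] I §13)

Topic `Literature/AlgebraicGeometry/AbelianSchemes`; namespace `Literature.AlgebraicGeometry.AbelianSchemes.WeilPairing` (sibling of ★ `WeilPairingHom`,
★ `WeilDualityPolarizationTransport`).  THEOREMS ONLY (no definition, no named fact, no instance, no notation, no `sorry`).  Cell `hodgecm-mathlib`
(D-0151), P6 «MOD programme» (crux hLiu418 = stmt-HodgeConjecture-24832, `--supports`, count-neutral), half-A line L3 (socket `stub_ROOF0`, (rL-asm)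
`w`-block): the isotropy input **(I-iso)** of the (KW) socket `hKW` of the `w`-block congruence relation (W-DOCK `WBlockLaw.rL_W'`; F0P6b-plan (g5) ED. 4
organ `hKW_of_isotropy_of_finrank`), in the W-line's own currency (realisations `j : G ↪ A` of `A[q]`, `ĵ : Ĝ ↪ Â`, a Weil duality `w_A : Ĝ_A → G_A^D`
NATURAL in homomorphisms, the lift `ℓ` of `λ|_{A[q]}`, `e₀ := ℓ ≫ w_A`), ALL `T`-points, NO pairing values.  HONEST LABEL: HC_CM is proved only modulo the
2 remaining named inputs (hLiu418 24832, h413 24833) until rung 0 closes; this file is generic and discharges none of them.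

THE MATHEMATICS.  Let `q̄ : A → B` be a homomorphism of abelian `k`-schemes with the DESCENT ROW `q̄ ≫ λ_B ≫ q̄^∨ = λ ≫ [a]_Â` (★ `dualIsogenyOver`, ★
`mulN`), `n = a·m`, realisations `j_A : G_A ↪ A`, `ĵ_A : Ĝ_A ↪ Â` (a monomorphism), `ĵ_B : Ĝ_B ↪ B̂` of `B̂[n]` (all `T`-points), lifts `β : G_A → G_B` of
`q̄` and `β^d : Ĝ_B → Ĝ_A` of `q̄^∨` (`β^d ≫ ĵ_A = ĵ_B ≫ q̄^∨`), Weil dualities `w_A`, `w_B` with the NATURALITY SQUARE `β^d ≫ w_A = w_B ≫ β^D`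
([MumfordAV1970] §20 (I): `e(q̄ x, ŷ) = e(x, q̄^∨ ŷ)`; ★ `WeilPairingHom.weilHom_natural`, the W-line's `WeilFamily.IsNatural`), the lift `ℓ : G_A → Ĝ_A` of
`λ` (`ℓ ≫ ĵ_A = j_A ≫ λ`), and a closed subgroup `φ : 𝒦 ↪ G_A` KILLED BY `β` (`𝒦 ⊆ Ker q̄ ∩ A[n]`).  Then for every `T`-point `x₀` of `G_A` whose
`m`-th multiple is killed by `q̄` (`x₀ ≫ j_A ≫ [m] ≫ q̄ = 1`): **`(x₀ ≫ ℓ ≫ w_A) ≫ φ^D = 1`** — the character `e₀(x₀) = e_q(·, λ x₀)` is trivial on `𝒦`.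
PROOF (no theta groups, no level shift): `[a] : A → A` is an fppf epimorphism, so on the finite flat cover `T′ := T ×_{x₀, A, [a]} A → T` there is `x₁`
with `a·x₁ = x₀|_{T′}`; then `λ(x₀|_{T′}) = (λ ≫ [a])(x₁) = q̄^∨(λ_B(q̄ x₁))` and `ĉ := λ_B(q̄ x₁)` is `n`-TORSION (`n·ĉ = λ_B q̄ (m·(a·x₁)) = λ_B q̄ (m·x₀) = 1`
— this is where `m·x₀ ∈ Ker q̄` enters), so `ĉ` is a `T′`-point `c` of `Ĝ_B` with `c ≫ β^d = (x₀ ≫ ℓ)|_{T′}` (`ĵ_A` mono); by naturality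
`(c ≫ β^d ≫ w_A) ≫ φ^D = c ≫ w_B ≫ (φ ≫ β)^D = c ≫ w_B ≫ 1^D = 1` (★ `cartierDualMap_comp`, ★ `cartierDualMap_of_eq_one`); and a `T`-point of `𝒦^D`
that becomes `1` on an fppf cover is `1` (`t` is an epimorphism of schemes, Mathlib `Flat.epi_of_flat_of_surjective` + `Over.epi_of_epi_left`).
The case `m = 1` (`x₀ ∈ Ker q̄`, `c` GLOBAL) is the W-line's (iso) law `PolarisedIsogenyKernelIsotropic` / ★ `WeilFamily.comp_comp_cartierDualMap_eq_one_of_isNatural`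
pattern; the pairing-value twin (★ `weilUnit` currency) is ★ `WeilUnitKernelIsotropicShifted`.

* §1 **`comp_comp_cartierDualMap_eq_one_of_natural_of_mulN_comp_eq_one`** — THE HEAD (`mulN` currency for the shift);
  **`…_of_zsmul_comp_eq_one`** — the same with the shift read as `(m : ℤ) • 𝟙 A` (the W-DOCK's torsion currency).

## References
* [MumfordAV1970] D. Mumford, *Abelian Varieties* (1970), §20 (I) (p. 186), (IV) (p. 187), §23 Thm. 2 (p. 231), §15 Thm. 1 (p. 143).
* [MilneAV2008] J. S. Milne, *Abelian Varieties* (2008), I §11, I §13 (the `e^λ_n`-pairing).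
* [Tate1997FiniteFlatGroupSchemes] J. Tate, *Finite flat group schemes* (1997), §(3.8) p. 145 (`f^D`, functoriality).
* [GortzWedhorn2020] U. Görtz, T. Wedhorn, *Algebraic Geometry I*, 2nd ed. (2020), (14.20) (fpqc descent); Def. 4.45 (2) (p. 117).
-/

set_option autoImplicit false

noncomputable section

-- Mathlib's `Over`/`Scheme` APIs are stated across semireducible wrappers (as in ★ `WeilDualityPolarizationTransport`, ★ `GroupSchemes/*`).
set_option backward.isDefEq.respectTransparency false

universe u

open CategoryTheory CategoryTheory.Limits AlgebraicGeometry MonoidalCategory CartesianMonoidalCategory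
open scoped MonObj

namespace Literature.AlgebraicGeometry.AbelianSchemes.WeilPairing

open Literature.AlgebraicGeometry.GroupSchemes Literature.AlgebraicGeometry.GroupSchemes.AffineGroupScheme
open Literature.AlgebraicGeometry.Motives Literature.AlgebraicGeometry.Motives.AbelianVariety
open Literature.AlgebraicGeometry.AbelianSchemes.AbelianSchemeOver Literature.AlgebraicGeometry.AbelianSchemes.AbelianSchemeOver.DualPair

/-! ## §1 The head: shifted isotropy through a natural Weil duality, all `T`-points -/

section Shifted

variable {k : Type u} [Field k] {A B : AbelianSchemeOver (Spec (CommRingCat.of k))} (qbar : A.X ⟶ B.X) [IsMonHom qbar]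
  (DA : A.DualPair) (DB : B.DualPair) (lam : A.X ⟶ DA.hat.X) [IsMonHom lam] (lamB : B.X ⟶ DB.hat.X) [IsMonHom lamB] (n a m : ℕ)
  -- realisations: `j_A : G_A → A` (any morphism), `ĵ_A : Ĝ_A ↪ Â` (mono), `ĵ_B : Ĝ_B ↪ B̂` realising `B̂[n]` on all `T`-points
  {GA : SchemeOver k} [GrpObj GA] [IsCommMonObj GA] [IsAffine GA.left] (jA : GA ⟶ A.X)
  {ĜA : SchemeOver k} (ĵA : ĜA ⟶ DA.hat.X) [Mono ĵA]
  {GB : SchemeOver k} [GrpObj GB] [IsCommMonObj GB] [IsAffine GB.left]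
  {ĜB : SchemeOver k} (ĵB : ĜB ⟶ DB.hat.X)
  (hĜB : ∀ ⦃T : SchemeOver k⦄ (t : T ⟶ DB.hat.X),
    (∃ s : T ⟶ ĜB, s ≫ ĵB = t) ↔ t ≫ ((((n : ℕ) : ℤ) • 𝟙 DB.hat.toAffine.toAbelianVariety).hom.hom.hom) = 1)
  -- the lifts of `q̄` and `q̄^∨`, the two Weil dualities with their NATURALITY square, the lift `ℓ` of `λ`
  (β : GA ⟶ GB) [IsMonHom β] (βd : ĜB ⟶ ĜA) (hβd : βd ≫ ĵA = ĵB ≫ dualIsogenyOver qbar DA DB)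
  (wA : ĜA ⟶ cartierDual GA) (wB : ĜB ⟶ cartierDual GB) (hnat : βd ≫ wA = wB ≫ cartierDualMap β)
  (ℓ : GA ⟶ ĜA) (hℓ : ℓ ≫ ĵA = jA ≫ lam)
  -- the closed subgroup `𝒦 ↪ G_A` killed by `β`
  {K : SchemeOver k} [GrpObj K] [IsCommMonObj K] [IsAffine K.left] [Module.Free k (Alg K)] [Module.Finite k (Alg K)]
  (φK : K ⟶ GA) [IsMonHom φK] (hK : φK ≫ β = 1)

include hĜB hβd hnat hℓ hK in
/-- **SHIFTED ISOTROPY THROUGH A NATURAL WEIL DUALITY** ([MumfordAV1970] §20 (I) + §23 Thm. 2, scheme-theoretically, all `T`-points, no pairing values):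
with the descent row `q̄ ≫ λ_B ≫ q̄^∨ = λ ≫ [a]`, `a·m = n ≠ 0`, a realisation `ĵ_B : Ĝ_B ↪ B̂` of `B̂[n]`, lifts `β`, `β^d` of `q̄`, `q̄^∨`, Weil dualities with
`β^d ≫ w_A = w_B ≫ β^D`, the lift `ℓ` of `λ`, and `φ : 𝒦 ↪ G_A` killed by `β`: for every `T`-point `x₀` of `G_A` with `x₀ ≫ j_A ≫ [m] ≫ q̄ = 1`,
`(x₀ ≫ ℓ ≫ w_A) ≫ φ^D = 1` («`e₀(x₀)` is trivial on `𝒦`»).  (On the fppf cover `[a]`: `x₀ = a·x₁`, `λ x₀ = q̄^∨ ĉ` with `ĉ = λ_B(q̄ x₁) ∈ B̂[n]` since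
`n·ĉ = λ_B q̄ (m·x₀) = 1`; naturality gives `c ≫ w_B ≫ (φ ≫ β)^D = 1`; descend along the epimorphism.)
[cite: MumfordAV1970, §20 (I) (p. 186); §23 Thm. 2 (p. 231)] [cite: Tate1997FiniteFlatGroupSchemes, §(3.8) p. 145] [cite: MilneAV2008, I §13] -/
theorem comp_comp_cartierDualMap_eq_one_of_natural_of_mulN_comp_eq_one (hn : n ≠ 0) (ham : a * m = n)
    (r3 : qbar ≫ lamB ≫ dualIsogenyOver qbar DA DB = lam ≫ DA.hat.mulN a)
    ⦃T : SchemeOver k⦄ (x₀ : T ⟶ GA) (hx₀ : ((x₀ ≫ jA) ≫ A.mulN m) ≫ qbar = 1) :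
    (x₀ ≫ ℓ ≫ wA) ≫ cartierDualMap φK = 1 := by
  have ha : a ≠ 0 := by
    rintro rfl
    exact hn (by rw [← ham, zero_mul])
  -- (1) the finite flat cover `t : T′ → T` on which `y := x₀ ≫ j_A` becomes divisible by `a`
  haveI : IsFinite (A.mulN a).left := by rw [mulN_def]; exact A.isFinite_pow_id_left_of_ne_zero ha
  haveI : Flat (A.mulN a).left := by rw [mulN_def]; exact A.flat_pow_id_left_of_ne_zero ha
  haveI : Surjective (A.mulN a).left := by rw [mulN_def]; exact A.surjective_pow_id_left_of_ne_zero ha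
  let t : pullback (x₀ ≫ jA).left (A.mulN a).left ⟶ T.left := pullback.fst (x₀ ≫ jA).left (A.mulN a).left
  let x₁₀ : pullback (x₀ ≫ jA).left (A.mulN a).left ⟶ A.X.left := pullback.snd (x₀ ≫ jA).left (A.mulN a).left
  have hcond : t ≫ (x₀ ≫ jA).left = x₁₀ ≫ (A.mulN a).left := pullback.condition
  haveI : IsFinite t := MorphismProperty.pullback_fst _ _ inferInstance
  haveI : Flat t := MorphismProperty.pullback_fst _ _ inferInstance
  haveI : Surjective t := MorphismProperty.pullback_fst _ _ inferInstance
  haveI : Epi t := Flat.epi_of_flat_of_surjective t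
  -- the cover as a `k`-scheme `T′` with its structure morphism `tO : T′ ⟶ T`
  let T' : SchemeOver k := Over.mk (t ≫ T.hom)
  let tO : T' ⟶ T := Over.homMk t rfl
  haveI : Epi tO := Over.epi_of_epi_left tO (hk := ‹Epi t›)
  -- (2) the `a`-th root `x₁` of `y` over `T′`
  have hx₁₀ : x₁₀ ≫ A.X.hom = t ≫ T.hom := by
    have h1 : x₁₀ ≫ A.X.hom = (x₁₀ ≫ (A.mulN a).left) ≫ A.X.hom := by rw [Category.assoc, Over.w]
    rw [h1, ← hcond, Category.assoc, Over.w (x₀ ≫ jA)]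
  let x₁ : T' ⟶ A.X := Over.homMk x₁₀ hx₁₀
  have key1 : x₁ ≫ A.mulN a = tO ≫ x₀ ≫ jA := by
    ext1
    exact hcond.symm
  -- homomorphisms commute with `[N]`
  have hmulL : A.mulN a ≫ lam = lam ≫ DA.hat.mulN a := by
    rw [mulN_def, mulN_def, MonObj.pow_comp, MonObj.comp_pow, Category.id_comp, Category.comp_id]
  -- (3) the point `ĉ₀ := λ_B (q̄ x₁)` of `B̂` is `n`-torsion BECAUSE `m·x₀ ∈ Ker q̄`
  have hx₁pow : x₁ ^ a = tO ≫ x₀ ≫ jA := by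
    rw [← key1, mulN_def, MonObj.comp_pow, Category.comp_id]
  have hym : ((x₀ ≫ jA) ^ m) ≫ qbar = 1 := by
    have h : (x₀ ≫ jA) ^ m = (x₀ ≫ jA) ≫ A.mulN m := by rw [mulN_def, MonObj.comp_pow, Category.comp_id]
    rw [h]
    exact hx₀
  have hc₀ : (x₁ ≫ qbar ≫ lamB) ≫ ((((n : ℕ) : ℤ) • 𝟙 DB.hat.toAffine.toAbelianVariety).hom.hom.hom) = 1 := by
    rw [comp_zsmul_id_hom_eq_pow', ← Category.assoc, ← MonObj.pow_comp, ← MonObj.pow_comp, ← ham, pow_mul, hx₁pow, ← MonObj.comp_pow,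
      Category.assoc tO, hym, MonObj.comp_one, MonObj.one_comp]
  obtain ⟨c, hc⟩ := (hĜB (x₁ ≫ qbar ≫ lamB)).mpr hc₀
  -- (4) `c ≫ β^d = (x₀ ≫ ℓ)|_{T′}` (compare after the monomorphism `ĵ_A`)
  have key3 : c ≫ βd = (tO ≫ x₀) ≫ ℓ := by
    rw [← cancel_mono ĵA]
    calc (c ≫ βd) ≫ ĵA = (x₁ ≫ qbar ≫ lamB) ≫ dualIsogenyOver qbar DA DB := by rw [Category.assoc, hβd, ← Category.assoc, hc]
      _ = x₁ ≫ (qbar ≫ lamB ≫ dualIsogenyOver qbar DA DB) := by simp only [Category.assoc]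
      _ = (x₁ ≫ A.mulN a) ≫ lam := by rw [r3, Category.assoc, hmulL]
      _ = ((tO ≫ x₀) ≫ ℓ) ≫ ĵA := by rw [key1]; simp only [Category.assoc, hℓ]
  -- (5) naturality: on the cover the character is `c ≫ w_B ≫ (φ ≫ β)^D = 1`
  have h5 : tO ≫ ((x₀ ≫ ℓ ≫ wA) ≫ cartierDualMap φK) = tO ≫ 1 := by
    calc tO ≫ ((x₀ ≫ ℓ ≫ wA) ≫ cartierDualMap φK)
        = (((tO ≫ x₀) ≫ ℓ) ≫ wA) ≫ cartierDualMap φK := by simp only [Category.assoc]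
      _ = ((c ≫ βd) ≫ wA) ≫ cartierDualMap φK := by rw [key3]
      _ = c ≫ (βd ≫ wA) ≫ cartierDualMap φK := by simp only [Category.assoc]
      _ = c ≫ wB ≫ (cartierDualMap β ≫ cartierDualMap φK) := by rw [hnat]; simp only [Category.assoc]
      _ = c ≫ wB ≫ cartierDualMap (φK ≫ β) := by rw [cartierDualMap_comp]
      _ = tO ≫ 1 := by rw [cartierDualMap_of_eq_one (φK ≫ β) hK, MonObj.comp_one, MonObj.comp_one, MonObj.comp_one]
  -- (6) descend along the epimorphism `tO`
  exact (cancel_epi tO).mp h5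

include hĜB hβd hnat hℓ hK in
/-- **THE SAME WITH THE SHIFT IN THE TORSION-PIN CURRENCY `(m : ℤ) • 𝟙 A`** (the W-DOCK's reading of `[m]`, ★ `comp_zsmul_id_hom_eq_pow'`): for `x₀` with
`x₀ ≫ j_A ≫ (m • 𝟙 A) ≫ q̄ = 1`, `(x₀ ≫ ℓ ≫ w_A) ≫ φ^D = 1`. [cite: MumfordAV1970, §20 (I) (p. 186); §23 Thm. 2 (p. 231)] [cite: Tate1997FiniteFlatGroupSchemes, §(3.8) p. 145] -/
theorem comp_comp_cartierDualMap_eq_one_of_natural_of_zsmul_comp_eq_one (hn : n ≠ 0) (ham : a * m = n)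
    (r3 : qbar ≫ lamB ≫ dualIsogenyOver qbar DA DB = lam ≫ DA.hat.mulN a)
    ⦃T : SchemeOver k⦄ (x₀ : T ⟶ GA)
    (hx₀ : ((x₀ ≫ jA) ≫ ((((m : ℕ) : ℤ) • 𝟙 A.toAffine.toAbelianVariety).hom.hom.hom)) ≫ qbar = 1) :
    (x₀ ≫ ℓ ≫ wA) ≫ cartierDualMap φK = 1 := by
  refine comp_comp_cartierDualMap_eq_one_of_natural_of_mulN_comp_eq_one qbar DA DB lam lamB n a m jA ĵA ĵB hĜB β βd hβd wA wB hnat ℓ hℓ φK hK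
    hn ham r3 x₀ ?_
  have h : (x₀ ≫ jA) ≫ A.mulN m = (x₀ ≫ jA) ≫ ((((m : ℕ) : ℤ) • 𝟙 A.toAffine.toAbelianVariety).hom.hom.hom) := by
    rw [comp_zsmul_id_hom_eq_pow', mulN_def, MonObj.comp_pow, Category.comp_id]
  rw [h]
  exact hx₀

end Shifted

end Literature.AlgebraicGeometry.AbelianSchemes.WeilPairing

end
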